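import Mathlib
import Summits.ValiantsHypothesis.ValiantsHypothesis.Theorems.KPlusLogSqLawStepFourOrder
import Summits.ValiantsHypothesis.ValiantsHypothesis.Theorems.KPlusLogSqLawStepTripleDual

/-!
# The FOUR-STEP LAW — the two look-back cases at window level (static path model behind `KPlusLogSqLaw.TropicalB`)

Cell pub-symmetroid, seat conjb-2 (g23). A helper toward the crux `TropicalB`
(`Summit.ValiantsHypothesis.ValiantsHypothesis.Theses.KPlusLogSqLaw.TropicalB`, item
`stmt-ValiantsHypothesis-19771`); it earns no crux credit and is not evidence for `MatrixDescartes` or for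
Valiant's hypothesis.

SETTING (abstract upper class `up : ℕ → Prop`, as in `KPlusLogSqLawStepFourOrder`): lines `S_t(θ) = b t + s t * θ`;
the window `[u, v]` is separated at `θ` iff every `up` line of `[u, v]` is strictly above every non-`up` line of
`[u, v]` at `θ`; `T[u, v]` is its separation set; row `j` (reach `d`) STEPS iff `T[j, j+d]`, `T[j+1, j+d+1]` are
non-empty and disjoint, and MOVES RIGHT (LEFT) iff `T[j, j+d]` lies to the left (right) of `T[j+1, j+d+1]`.

CONTENT (FOUR-STEP LAW, THEORY-NOTE-g21 §3.1sexies / g22 §1quater, middle pattern `(R, L)` on rows `i, …, i+3`, class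
pattern `¬ up (i+1)`, `up (i+2)`, `¬ up (i+3)`, `up (i+d+1)`, `¬ up (i+d+2)`, `up (i+d+3)`, `¬ up (i+d+4)`, `d ≥ 3`).
* `mono_low` — the lower-line monotonicity `s (i+3) < s (i+d+2)` (`KPlusLogSqLawStepTripleDual.triple_mid_left_low`
  on rows `i+1, i+2, i+3`, re-bracketed); with `triple_mid_right` (`s (i+2) < s (i+d+1)`) it feeds the whole-interval
  orders `T[i, i+d] < T[i+3, i+d+3]`, `T[i+4, i+d+4] < T[i+1, i+d+1]` of `KPlusLogSqLawStepFourOrder`.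
* `new_low_le` / `old_up_le` — WITNESS REDUCTION for row exactness: on `T[i+1, i+d+1]` the non-separation of
  `[i+1, i+d+2]` is witnessed by the pair `(i+2, i+d+2)` as soon as every other upper line beats the new lower line
  `i+d+2` there (and dually on `T[i+3, i+d+3]` for the old upper line `i+2`); the other pairs are positive because
  they lie in two windows separated on both sides of the point (`affine_pos_between`).
* `four_lrl` — the direction pattern `(L, R, L, ·)` is impossible: at `r₁ = sup T[i+1, i+d+1]` the look-back partner
  of line `i+1` is `i+d+1` (`KPlusLogSqLawStepTriple.lookback_partner`), and `KPlusLogSqLawStepFour.four_lrll_core`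
  closes with a point of `T[i+4, i+d+4]` left of `r₁` and a point of `T[i+3, i+d+3]` right of it.
* `four_rlr` — the direction pattern `(·, R, L, R)` is impossible (needs also `up (i+4)`): at
  `r₃ = sup T[i+3, i+d+3]` the look-back partner of line `i+3` is `i+d+3`, row-`(i+2)` exactness gives
  `S_{i+2}(r₃) ≤ S_{i+d+2}(r₃) ≤ S_{i+d+3}(r₃) = S_{i+3}(r₃)`, while `S_{i+2} - S_{i+3} > 0` on `T[i, i+d]` (left of `r₃`)
  and on `T[i+1, i+d+1]` (right of `r₃`).
The remaining sub-pattern `(R, R, L, L)` (the squeeze, `four_rrll_core`) and the dispatch over the outer directions,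
the reflected middle pattern `(L, R)` and the even/odd bridge to `KPlusLogSqLawStepLength.consecutive_steps_le_of_four`
are the sequel.
-/

set_option linter.dupNamespace false

namespace Summit.ValiantsHypothesis.ValiantsHypothesis.Theorems.KPlusLogSqLawStepFourLook

open Summit.ValiantsHypothesis.ValiantsHypothesis.Theorems.KPlusLogSqLawStepTriple (lookback_partner)
open Summit.ValiantsHypothesis.ValiantsHypothesis.Theorems.KPlusLogSqLawStepFour
  (affine_three_point affine_le_at_sup four_lrll_core)
open Summit.ValiantsHypothesis.ValiantsHypothesis.Theorems.KPlusLogSqLawStepFourOrder (sep0_lt_sep3 sep4_lt_sep1)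
open Summit.ValiantsHypothesis.ValiantsHypothesis.Theorems.KPlusLogSqLawStepTripleDual
  (triple_mid_right triple_mid_left_low)

/-- Re-bracketing of the bounds of a window (`i + 1 + d` versus `i + d + 1` and the like). -/
theorem sep_cast (up : ℕ → Prop) (s b : ℕ → ℝ) (lo hi lo' hi' : ℕ) (h1 : lo = lo') (h2 : hi = hi') (θ : ℝ)
    (hh : (∀ e o : ℕ, lo ≤ e → e ≤ hi → lo ≤ o → o ≤ hi → up e → ¬ up o → b o + s o * θ < b e + s e * θ)) :
    (∀ e o : ℕ, lo' ≤ e → e ≤ hi' → lo' ≤ o → o ≤ hi' → up e → ¬ up o → b o + s o * θ < b e + s e * θ) := by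
  intro e o g1 g2 g3 g4
  exact hh e o (by omega) (by omega) (by omega) (by omega)

/-- LOWER-LINE MONOTONICITY `s (i+3) < s (i+d+2)`: the dual triple law `triple_mid_left_low` on rows `i+1, i+2, i+3`
(row `i+2` moves left, rows `i+1`, `i+3` move either way), re-bracketed to the windows `[i+k, i+d+k]`. -/
theorem mono_low (up : ℕ → Prop) (s b : ℕ → ℝ) (i d : ℕ) (hd : 2 ≤ d) (hup2 : up (i + 2)) (hlow3 : ¬ up (i + 3))
    (hlow2 : ¬ up (i + d + 2)) (hup3 : up (i + d + 3)) (hlow4 : ¬ up (i + d + 4))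
    (hA1 : ∃ θ : ℝ, (∀ e o : ℕ, i + 1 ≤ e → e ≤ i + d + 1 → i + 1 ≤ o → o ≤ i + d + 1 → up e → ¬ up o → b o + s o * θ < b e + s e * θ)) (hA2 : ∃ θ : ℝ,
          (∀ e o : ℕ, i + 2 ≤ e → e ≤ i + d + 2 → i + 2 ≤ o → o ≤ i + d + 2 → up e → ¬ up o → b o + s o * θ < b e + s e * θ))
    (hA3 : ∃ θ : ℝ, (∀ e o : ℕ, i + 3 ≤ e → e ≤ i + d + 3 → i + 3 ≤ o → o ≤ i + d + 3 → up e → ¬ up o → b o + s o * θ < b e + s e * θ)) (hA4 : ∃ θ : ℝ,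
          (∀ e o : ℕ, i + 4 ≤ e → e ≤ i + d + 4 → i + 4 ≤ o → o ≤ i + d + 4 → up e → ¬ up o → b o + s o * θ < b e + s e * θ))
    (hdis1 : ∀ θ : ℝ, ¬ ((∀ e o : ℕ, i + 1 ≤ e → e ≤ i + d + 1 → i + 1 ≤ o → o ≤ i + d + 1 → up e → ¬ up o → b o + s o * θ < b e + s e * θ) ∧
          (∀ e o : ℕ, i + 2 ≤ e → e ≤ i + d + 2 → i + 2 ≤ o → o ≤ i + d + 2 → up e → ¬ up o → b o + s o * θ < b e + s e * θ)))
    (hdis2 : ∀ θ : ℝ, ¬ ((∀ e o : ℕ, i + 2 ≤ e → e ≤ i + d + 2 → i + 2 ≤ o → o ≤ i + d + 2 → up e → ¬ up o → b o + s o * θ < b e + s e * θ) ∧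
          (∀ e o : ℕ, i + 3 ≤ e → e ≤ i + d + 3 → i + 3 ≤ o → o ≤ i + d + 3 → up e → ¬ up o → b o + s o * θ < b e + s e * θ)))
    (hdis3 : ∀ θ : ℝ, ¬ ((∀ e o : ℕ, i + 3 ≤ e → e ≤ i + d + 3 → i + 3 ≤ o → o ≤ i + d + 3 → up e → ¬ up o → b o + s o * θ < b e + s e * θ) ∧
          (∀ e o : ℕ, i + 4 ≤ e → e ≤ i + d + 4 → i + 4 ≤ o → o ≤ i + d + 4 → up e → ¬ up o → b o + s o * θ < b e + s e * θ)))
    (hdir1 : (∀ θ θ' : ℝ, (∀ e o : ℕ, i + 1 ≤ e → e ≤ i + d + 1 → i + 1 ≤ o → o ≤ i + d + 1 → up e → ¬ up o → b o + s o * θ < b e + s e * θ) →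
          (∀ e o : ℕ, i + 2 ≤ e → e ≤ i + d + 2 → i + 2 ≤ o → o ≤ i + d + 2 → up e → ¬ up o → b o + s o * θ' < b e + s e * θ') → θ < θ') ∨
      (∀ θ θ' : ℝ, (∀ e o : ℕ, i + 1 ≤ e → e ≤ i + d + 1 → i + 1 ≤ o → o ≤ i + d + 1 → up e → ¬ up o → b o + s o * θ < b e + s e * θ) →
            (∀ e o : ℕ, i + 2 ≤ e → e ≤ i + d + 2 → i + 2 ≤ o → o ≤ i + d + 2 → up e → ¬ up o → b o + s o * θ' < b e + s e * θ') → θ' < θ))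
    (hL2 : ∀ θ θ' : ℝ, (∀ e o : ℕ, i + 2 ≤ e → e ≤ i + d + 2 → i + 2 ≤ o → o ≤ i + d + 2 → up e → ¬ up o → b o + s o * θ < b e + s e * θ) →
          (∀ e o : ℕ, i + 3 ≤ e → e ≤ i + d + 3 → i + 3 ≤ o → o ≤ i + d + 3 → up e → ¬ up o → b o + s o * θ' < b e + s e * θ') → θ' < θ)
    (hdir3 : (∀ θ θ' : ℝ, (∀ e o : ℕ, i + 3 ≤ e → e ≤ i + d + 3 → i + 3 ≤ o → o ≤ i + d + 3 → up e → ¬ up o → b o + s o * θ < b e + s e * θ) →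
          (∀ e o : ℕ, i + 4 ≤ e → e ≤ i + d + 4 → i + 4 ≤ o → o ≤ i + d + 4 → up e → ¬ up o → b o + s o * θ' < b e + s e * θ') → θ < θ') ∨
      (∀ θ θ' : ℝ, (∀ e o : ℕ, i + 3 ≤ e → e ≤ i + d + 3 → i + 3 ≤ o → o ≤ i + d + 3 → up e → ¬ up o → b o + s o * θ < b e + s e * θ) →
            (∀ e o : ℕ, i + 4 ≤ e → e ≤ i + d + 4 → i + 4 ≤ o → o ≤ i + d + 4 → up e → ¬ up o → b o + s o * θ' < b e + s e * θ') → θ' < θ)) :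
    s (i + 3) < s (i + d + 2) := by
  have key := triple_mid_left_low up s b (i + 1) d hd
    (by rw [(by omega : i + 1 + 1 = i + 2)]; exact hup2)
    (by rw [(by omega : i + 1 + 2 = i + 3)]; exact hlow3)
    (by rw [(by omega : i + 1 + d + 1 = i + d + 2)]; exact hlow2)
    (by rw [(by omega : i + 1 + d + 2 = i + d + 3)]; exact hup3)
    (by rw [(by omega : i + 1 + d + 3 = i + d + 4)]; exact hlow4)
    (hA1.imp fun θ h => sep_cast up s b _ _ _ _ rfl (by omega) θ h)
    (hA2.imp fun θ h => sep_cast up s b _ _ _ _ (by omega) (by omega) θ h)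
    (hA3.imp fun θ h => sep_cast up s b _ _ _ _ (by omega) (by omega) θ h)
    (hA4.imp fun θ h => sep_cast up s b _ _ _ _ (by omega) (by omega) θ h)
    (fun θ h => hdis1 θ ⟨sep_cast up s b _ _ _ _ rfl (by omega) θ h.1, sep_cast up s b _ _ _ _ (by omega) (by omega) θ h.2⟩)
    (fun θ h => hdis2 θ ⟨sep_cast up s b _ _ _ _ (by omega) (by omega) θ h.1,
      sep_cast up s b _ _ _ _ (by omega) (by omega) θ h.2⟩)
    (fun θ h => hdis3 θ ⟨sep_cast up s b _ _ _ _ (by omega) (by omega) θ h.1,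
      sep_cast up s b _ _ _ _ (by omega) (by omega) θ h.2⟩)
    (hdir1.imp
      (fun hR θ θ' h h' => hR θ θ' (sep_cast up s b _ _ _ _ rfl (by omega) θ h)
        (sep_cast up s b _ _ _ _ (by omega) (by omega) θ' h'))
      (fun hL θ θ' h h' => hL θ' θ (sep_cast up s b _ _ _ _ rfl (by omega) θ' h')
        (sep_cast up s b _ _ _ _ (by omega) (by omega) θ h)))
    (fun θ θ' h h' => hL2 θ θ' (sep_cast up s b _ _ _ _ (by omega) (by omega) θ h)
      (sep_cast up s b _ _ _ _ (by omega) (by omega) θ' h'))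
    (hdir3.imp
      (fun hR θ θ' h h' => hR θ θ' (sep_cast up s b _ _ _ _ (by omega) (by omega) θ h)
        (sep_cast up s b _ _ _ _ (by omega) (by omega) θ' h'))
      (fun hL θ θ' h h' => hL θ θ' (sep_cast up s b _ _ _ _ (by omega) (by omega) θ h)
        (sep_cast up s b _ _ _ _ (by omega) (by omega) θ' h')))
  have e1 : i + 1 + 2 = i + 3 := by omega
  have e2 : i + 1 + d + 1 = i + d + 2 := by omega
  rw [e1, e2] at key
  exact key

/-- An affine function positive at `a` and at `c` is positive at every point between them. -/
theorem affine_pos_between (g0 g1 a c θ : ℝ) (ha : a ≤ θ) (hc : θ ≤ c) (ha' : 0 < g0 + g1 * a)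
    (hc' : 0 < g0 + g1 * c) : 0 < g0 + g1 * θ := by
  by_contra h
  exact affine_three_point g0 g1 θ a c (not_lt.mp h) ha ha' hc hc'

/-- If `T[i+1, i+d+1]` and `T[i+2, i+d+2]` have no common point `θ`, the union window `[i+1, i+d+2]` is not separated
at `θ` (row-`(i+1)` exactness). -/
theorem not_sep_right (up : ℕ → Prop) (s b : ℕ → ℝ) (i d : ℕ) (θ : ℝ)
    (hdis : ¬ ((∀ e o : ℕ, i + 1 ≤ e → e ≤ i + d + 1 → i + 1 ≤ o → o ≤ i + d + 1 → up e → ¬ up o → b o + s o * θ < b e + s e * θ) ∧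
          (∀ e o : ℕ, i + 2 ≤ e → e ≤ i + d + 2 → i + 2 ≤ o → o ≤ i + d + 2 → up e → ¬ up o → b o + s o * θ < b e + s e * θ))) :
    ¬ (∀ e o : ℕ, i + 1 ≤ e → e ≤ i + d + 2 → i + 1 ≤ o → o ≤ i + d + 2 → up e → ¬ up o → b o + s o * θ < b e + s e * θ) := by
  intro h
  exact hdis ⟨fun e o h1 h2 h3 h4 he ho => h e o h1 (by omega) h3 (by omega) he ho,
    fun e o h1 h2 h3 h4 he ho => h e o (by omega) h2 (by omega) h4 he ho⟩

/-- If `T[i+2, i+d+2]` and `T[i+3, i+d+3]` have no common point `θ`, the union window `[i+2, i+d+3]` is not separated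
at `θ` (row-`(i+2)` exactness). -/
theorem not_sep_left (up : ℕ → Prop) (s b : ℕ → ℝ) (i d : ℕ) (θ : ℝ)
    (hdis : ¬ ((∀ e o : ℕ, i + 2 ≤ e → e ≤ i + d + 2 → i + 2 ≤ o → o ≤ i + d + 2 → up e → ¬ up o → b o + s o * θ < b e + s e * θ) ∧
          (∀ e o : ℕ, i + 3 ≤ e → e ≤ i + d + 3 → i + 3 ≤ o → o ≤ i + d + 3 → up e → ¬ up o → b o + s o * θ < b e + s e * θ))) :
    ¬ (∀ e o : ℕ, i + 2 ≤ e → e ≤ i + d + 3 → i + 2 ≤ o → o ≤ i + d + 3 → up e → ¬ up o → b o + s o * θ < b e + s e * θ) := by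
  intro h
  exact hdis ⟨fun e o h1 h2 h3 h4 he ho => h e o h1 (by omega) h3 (by omega) he ho,
    fun e o h1 h2 h3 h4 he ho => h e o (by omega) h2 (by omega) h4 he ho⟩

/-- WITNESS REDUCTION (new lower line): if `[i+1, i+d+1]` is separated at `θ`, `[i+1, i+d+2]` is not, the new line
`i+d+2` is a lower line and every upper line of `[i+1, i+d+1]` other than `i+2` beats it at `θ`, then
`S_{i+2}(θ) ≤ S_{i+d+2}(θ)`. -/
theorem new_low_le (up : ℕ → Prop) (s b : ℕ → ℝ) (i d : ℕ) (θ : ℝ) (hlow2 : ¬ up (i + d + 2))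
    (hx : (∀ e o : ℕ, i + 1 ≤ e → e ≤ i + d + 1 → i + 1 ≤ o → o ≤ i + d + 1 → up e → ¬ up o → b o + s o * θ < b e + s e * θ))
    (hex : ¬ (∀ e o : ℕ, i + 1 ≤ e → e ≤ i + d + 2 → i + 1 ≤ o → o ≤ i + d + 2 → up e → ¬ up o → b o + s o * θ < b e + s e * θ))
    (hoth : ∀ e : ℕ, i + 1 ≤ e → e ≤ i + d + 1 → up e → e ≠ i + 2 → b (i + d + 2) + s (i + d + 2) * θ < b e + s e * θ) :
    b (i + 2) + s (i + 2) * θ ≤ b (i + d + 2) + s (i + d + 2) * θ := by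
  by_contra hgt
  have hlt : b (i + d + 2) + s (i + d + 2) * θ < b (i + 2) + s (i + 2) * θ := not_le.mp hgt
  apply hex
  intro e o h1 h2 h3 h4 he ho
  have he1 : e ≤ i + d + 1 := by
    by_contra hec
    have hee : e = i + d + 2 := by omega
    rw [hee] at he
    exact hlow2 he
  by_cases ho1 : o ≤ i + d + 1
  · exact hx e o h1 he1 h3 ho1 he ho
  · have hoo : o = i + d + 2 := by omega
    rw [hoo]
    by_cases he2 : e = i + 2
    · rw [he2]; exact hlt
    · exact hoth e h1 he1 he he2

/-- WITNESS REDUCTION (old upper line): if `[i+3, i+d+3]` is separated at `θ`, `[i+2, i+d+3]` is not, the old line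
`i+2` is an upper line and it beats every lower line of `[i+3, i+d+3]` other than `i+d+2` at `θ`, then
`S_{i+2}(θ) ≤ S_{i+d+2}(θ)`. -/
theorem old_up_le (up : ℕ → Prop) (s b : ℕ → ℝ) (i d : ℕ) (θ : ℝ) (hup2 : up (i + 2))
    (hy : (∀ e o : ℕ, i + 3 ≤ e → e ≤ i + d + 3 → i + 3 ≤ o → o ≤ i + d + 3 → up e → ¬ up o → b o + s o * θ < b e + s e * θ))
    (hex : ¬ (∀ e o : ℕ, i + 2 ≤ e → e ≤ i + d + 3 → i + 2 ≤ o → o ≤ i + d + 3 → up e → ¬ up o → b o + s o * θ < b e + s e * θ))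
    (hoth : ∀ o : ℕ, i + 3 ≤ o → o ≤ i + d + 3 → ¬ up o → o ≠ i + d + 2 → b o + s o * θ < b (i + 2) + s (i + 2) * θ) :
    b (i + 2) + s (i + 2) * θ ≤ b (i + d + 2) + s (i + d + 2) * θ := by
  by_contra hgt
  have hlt : b (i + d + 2) + s (i + d + 2) * θ < b (i + 2) + s (i + 2) * θ := not_le.mp hgt
  apply hex
  intro e o h1 h2 h3 h4 he ho
  have ho3 : i + 3 ≤ o := by
    by_contra hoc
    have hoo : o = i + 2 := by omega
    rw [hoo] at ho
    exact ho hup2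
  by_cases he3 : i + 3 ≤ e
  · exact hy e o he3 h2 ho3 h4 he ho
  · have hee : e = i + 2 := by omega
    rw [hee]
    by_cases ho2 : o = i + d + 2
    · rw [ho2]; exact hlt
    · exact hoth o ho3 h4 ho ho2

/-- FOUR-STEP LAW, pattern `(L, R, L, ·)`: rows `i, …, i+3` step, row `i` moves left, row `i+1` right, row `i+2` left
(row `i+3` either way) — impossible. -/
theorem four_lrl (up : ℕ → Prop) (s b : ℕ → ℝ) (i d : ℕ) (hd : 3 ≤ d) (hlow1 : ¬ up (i + 1)) (hup2 : up (i + 2))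
    (hlow3 : ¬ up (i + 3)) (hup1 : up (i + d + 1)) (hlow2 : ¬ up (i + d + 2)) (hup3 : up (i + d + 3))
    (hlow4 : ¬ up (i + d + 4))
    (hA0 : ∃ θ : ℝ, (∀ e o : ℕ, i ≤ e → e ≤ i + d → i ≤ o → o ≤ i + d → up e → ¬ up o → b o + s o * θ < b e + s e * θ)) (hA1 : ∃ θ : ℝ,
          (∀ e o : ℕ, i + 1 ≤ e → e ≤ i + d + 1 → i + 1 ≤ o → o ≤ i + d + 1 → up e → ¬ up o → b o + s o * θ < b e + s e * θ))
    (hA2 : ∃ θ : ℝ, (∀ e o : ℕ, i + 2 ≤ e → e ≤ i + d + 2 → i + 2 ≤ o → o ≤ i + d + 2 → up e → ¬ up o → b o + s o * θ < b e + s e * θ)) (hA3 : ∃ θ : ℝ,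
          (∀ e o : ℕ, i + 3 ≤ e → e ≤ i + d + 3 → i + 3 ≤ o → o ≤ i + d + 3 → up e → ¬ up o → b o + s o * θ < b e + s e * θ))
    (hA4 : ∃ θ : ℝ, (∀ e o : ℕ, i + 4 ≤ e → e ≤ i + d + 4 → i + 4 ≤ o → o ≤ i + d + 4 → up e → ¬ up o → b o + s o * θ < b e + s e * θ))
    (hdis0 : ∀ θ : ℝ, ¬ ((∀ e o : ℕ, i ≤ e → e ≤ i + d → i ≤ o → o ≤ i + d → up e → ¬ up o → b o + s o * θ < b e + s e * θ) ∧
          (∀ e o : ℕ, i + 1 ≤ e → e ≤ i + d + 1 → i + 1 ≤ o → o ≤ i + d + 1 → up e → ¬ up o → b o + s o * θ < b e + s e * θ)))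
    (hdis1 : ∀ θ : ℝ, ¬ ((∀ e o : ℕ, i + 1 ≤ e → e ≤ i + d + 1 → i + 1 ≤ o → o ≤ i + d + 1 → up e → ¬ up o → b o + s o * θ < b e + s e * θ) ∧
          (∀ e o : ℕ, i + 2 ≤ e → e ≤ i + d + 2 → i + 2 ≤ o → o ≤ i + d + 2 → up e → ¬ up o → b o + s o * θ < b e + s e * θ)))
    (hdis2 : ∀ θ : ℝ, ¬ ((∀ e o : ℕ, i + 2 ≤ e → e ≤ i + d + 2 → i + 2 ≤ o → o ≤ i + d + 2 → up e → ¬ up o → b o + s o * θ < b e + s e * θ) ∧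
          (∀ e o : ℕ, i + 3 ≤ e → e ≤ i + d + 3 → i + 3 ≤ o → o ≤ i + d + 3 → up e → ¬ up o → b o + s o * θ < b e + s e * θ)))
    (hdis3 : ∀ θ : ℝ, ¬ ((∀ e o : ℕ, i + 3 ≤ e → e ≤ i + d + 3 → i + 3 ≤ o → o ≤ i + d + 3 → up e → ¬ up o → b o + s o * θ < b e + s e * θ) ∧
          (∀ e o : ℕ, i + 4 ≤ e → e ≤ i + d + 4 → i + 4 ≤ o → o ≤ i + d + 4 → up e → ¬ up o → b o + s o * θ < b e + s e * θ)))
    (hL0 : ∀ θ θ' : ℝ, (∀ e o : ℕ, i ≤ e → e ≤ i + d → i ≤ o → o ≤ i + d → up e → ¬ up o → b o + s o * θ < b e + s e * θ) →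
          (∀ e o : ℕ, i + 1 ≤ e → e ≤ i + d + 1 → i + 1 ≤ o → o ≤ i + d + 1 → up e → ¬ up o → b o + s o * θ' < b e + s e * θ') → θ' < θ)
    (hR1 : ∀ θ θ' : ℝ, (∀ e o : ℕ, i + 1 ≤ e → e ≤ i + d + 1 → i + 1 ≤ o → o ≤ i + d + 1 → up e → ¬ up o → b o + s o * θ < b e + s e * θ) →
          (∀ e o : ℕ, i + 2 ≤ e → e ≤ i + d + 2 → i + 2 ≤ o → o ≤ i + d + 2 → up e → ¬ up o → b o + s o * θ' < b e + s e * θ') → θ < θ')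
    (hL2 : ∀ θ θ' : ℝ, (∀ e o : ℕ, i + 2 ≤ e → e ≤ i + d + 2 → i + 2 ≤ o → o ≤ i + d + 2 → up e → ¬ up o → b o + s o * θ < b e + s e * θ) →
          (∀ e o : ℕ, i + 3 ≤ e → e ≤ i + d + 3 → i + 3 ≤ o → o ≤ i + d + 3 → up e → ¬ up o → b o + s o * θ' < b e + s e * θ') → θ' < θ)
    (hdir3 : (∀ θ θ' : ℝ, (∀ e o : ℕ, i + 3 ≤ e → e ≤ i + d + 3 → i + 3 ≤ o → o ≤ i + d + 3 → up e → ¬ up o → b o + s o * θ < b e + s e * θ) →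
          (∀ e o : ℕ, i + 4 ≤ e → e ≤ i + d + 4 → i + 4 ≤ o → o ≤ i + d + 4 → up e → ¬ up o → b o + s o * θ' < b e + s e * θ') → θ < θ') ∨
      (∀ θ θ' : ℝ, (∀ e o : ℕ, i + 3 ≤ e → e ≤ i + d + 3 → i + 3 ≤ o → o ≤ i + d + 3 → up e → ¬ up o → b o + s o * θ < b e + s e * θ) →
            (∀ e o : ℕ, i + 4 ≤ e → e ≤ i + d + 4 → i + 4 ≤ o → o ≤ i + d + 4 → up e → ¬ up o → b o + s o * θ' < b e + s e * θ') → θ' < θ)) : False := by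
  have hd2 : 2 ≤ d := by omega
  -- the two monotonicities (triple laws) and the whole-interval orders
  have hmono : s (i + 2) < s (i + d + 1) :=
    triple_mid_right up s b i d hd2 hlow1 hup2 hup1 hlow2 hup3 hA0 hA1 hA2 hA3 hdis0 hdis1 hdis2
      (Or.inr fun θ θ' h h' => hL0 θ' θ h' h) hR1 (Or.inr hL2)
  have hmono' : s (i + 3) < s (i + d + 2) :=
    mono_low up s b i d hd2 hup2 hlow3 hlow2 hup3 hlow4 hA1 hA2 hA3 hA4 hdis1 hdis2 hdis3 (Or.inl hR1) hL2 hdir3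
  have h03 := sep0_lt_sep3 up s b i d hd2 hup2 hup1 hmono hdis0 hdis2
  have h41 := sep4_lt_sep1 up s b i d hd2 hlow3 hlow2 hmono' hdis1 hdis3
  -- the look-back structure at `r₁ = sup T[i+1, i+d+1]`
  obtain ⟨r₁, heq1, -, -, hdomr, hsup, happrox, -, hinf0⟩ :=
    lookback_partner up s b i d (by omega) hlow1 hup2 hlow2 hA0 hA1 hA2 (fun θ θ' h h' => hL0 θ' θ h' h) hdis1 hR1
  obtain ⟨θ₀, hθ₀⟩ := hA0
  obtain ⟨θ₁, hθ₁⟩ := hA1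
  obtain ⟨c, hc⟩ := hA3
  obtain ⟨a, ha⟩ := hA4
  have har : a ≤ r₁ := le_trans (le_of_lt (h41 a θ₁ ha hθ₁)) (hsup θ₁ hθ₁)
  have hcr : r₁ ≤ c := le_trans (hinf0 θ₀ hθ₀) (le_of_lt (h03 θ₀ c hθ₀ hc))
  have ha' : b (i + d + 2) + s (i + d + 2) * a < b (i + d + 1) + s (i + d + 1) * a :=
    ha (i + d + 1) (i + d + 2) (by omega) (by omega) (by omega) (by omega) hup1 hlow2
  have hc' : b (i + d + 2) + s (i + d + 2) * c < b (i + d + 1) + s (i + d + 1) * c :=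
    hc (i + d + 1) (i + d + 2) (by omega) (by omega) (by omega) (by omega) hup1 hlow2
  have hdom : b (i + 1) + s (i + 1) * r₁ ≤ b (i + 2) + s (i + 2) * r₁ :=
    hdomr (i + 2) (i + 1) (by omega) (by omega) (by omega) (by omega) hup2 hlow1
  -- row-`(i+1)` exactness near `r₁`, witnessed by the pair `(i+2, i+d+2)`
  have happ : ∀ ε : ℝ, 0 < ε → ∃ θ : ℝ, b (i + 2) + s (i + 2) * θ ≤ b (i + d + 2) + s (i + d + 2) * θ ∧
      r₁ - ε < θ ∧ θ ≤ r₁ := by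
    intro ε hε
    obtain ⟨θ, hθ, hθr⟩ := happrox ε hε
    refine ⟨θ, ?_, hθr, hsup θ hθ⟩
    refine new_low_le up s b i d θ hlow2 hθ (not_sep_right up s b i d θ (hdis1 θ)) ?_
    intro e h1 h2 he hne
    have he4 : i + 4 ≤ e := by
      by_contra hlt
      have h13 : e = i + 1 ∨ e = i + 3 := by omega
      rcases h13 with h13 | h13
      · rw [h13] at he; exact hlow1 he
      · rw [h13] at he; exact hlow3 he
    have hθa : a ≤ θ := le_of_lt (h41 a θ ha hθ)
    have hθc : θ ≤ c := le_of_lt (lt_trans (hL0 θ₀ θ hθ₀ hθ) (h03 θ₀ c hθ₀ hc))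
    have pa : b (i + d + 2) + s (i + d + 2) * a < b e + s e * a :=
      ha e (i + d + 2) he4 (by omega) (by omega) (by omega) he hlow2
    have pc : b (i + d + 2) + s (i + d + 2) * c < b e + s e * c :=
      hc e (i + d + 2) (by omega) (by omega) (by omega) (by omega) he hlow2
    have key := affine_pos_between (b e - b (i + d + 2)) (s e - s (i + d + 2)) a c θ hθa hθc (by linarith)
      (by linarith)
    linarith
  exact four_lrll_core (s (i + 1)) (b (i + 1)) (s (i + 2)) (b (i + 2)) (s (i + d + 1)) (b (i + d + 1))
    (s (i + d + 2)) (b (i + d + 2)) r₁ a c heq1 hdom happ har ha' hcr hc'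

/-- FOUR-STEP LAW, pattern `(·, R, L, R)`: rows `i, …, i+3` step, row `i+1` moves right, row `i+2` left, row `i+3`
right (row `i` either way), with `up (i+4)` — impossible. -/
theorem four_rlr (up : ℕ → Prop) (s b : ℕ → ℝ) (i d : ℕ) (hd : 3 ≤ d) (hlow1 : ¬ up (i + 1)) (hup2 : up (i + 2))
    (hlow3 : ¬ up (i + 3)) (hup4 : up (i + 4)) (hup1 : up (i + d + 1)) (hlow2 : ¬ up (i + d + 2))
    (hup3 : up (i + d + 3)) (hlow4 : ¬ up (i + d + 4))
    (hA0 : ∃ θ : ℝ, (∀ e o : ℕ, i ≤ e → e ≤ i + d → i ≤ o → o ≤ i + d → up e → ¬ up o → b o + s o * θ < b e + s e * θ)) (hA1 : ∃ θ : ℝ,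
          (∀ e o : ℕ, i + 1 ≤ e → e ≤ i + d + 1 → i + 1 ≤ o → o ≤ i + d + 1 → up e → ¬ up o → b o + s o * θ < b e + s e * θ))
    (hA2 : ∃ θ : ℝ, (∀ e o : ℕ, i + 2 ≤ e → e ≤ i + d + 2 → i + 2 ≤ o → o ≤ i + d + 2 → up e → ¬ up o → b o + s o * θ < b e + s e * θ)) (hA3 : ∃ θ : ℝ,
          (∀ e o : ℕ, i + 3 ≤ e → e ≤ i + d + 3 → i + 3 ≤ o → o ≤ i + d + 3 → up e → ¬ up o → b o + s o * θ < b e + s e * θ))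
    (hA4 : ∃ θ : ℝ, (∀ e o : ℕ, i + 4 ≤ e → e ≤ i + d + 4 → i + 4 ≤ o → o ≤ i + d + 4 → up e → ¬ up o → b o + s o * θ < b e + s e * θ))
    (hdis0 : ∀ θ : ℝ, ¬ ((∀ e o : ℕ, i ≤ e → e ≤ i + d → i ≤ o → o ≤ i + d → up e → ¬ up o → b o + s o * θ < b e + s e * θ) ∧
          (∀ e o : ℕ, i + 1 ≤ e → e ≤ i + d + 1 → i + 1 ≤ o → o ≤ i + d + 1 → up e → ¬ up o → b o + s o * θ < b e + s e * θ)))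
    (hdis1 : ∀ θ : ℝ, ¬ ((∀ e o : ℕ, i + 1 ≤ e → e ≤ i + d + 1 → i + 1 ≤ o → o ≤ i + d + 1 → up e → ¬ up o → b o + s o * θ < b e + s e * θ) ∧
          (∀ e o : ℕ, i + 2 ≤ e → e ≤ i + d + 2 → i + 2 ≤ o → o ≤ i + d + 2 → up e → ¬ up o → b o + s o * θ < b e + s e * θ)))
    (hdis2 : ∀ θ : ℝ, ¬ ((∀ e o : ℕ, i + 2 ≤ e → e ≤ i + d + 2 → i + 2 ≤ o → o ≤ i + d + 2 → up e → ¬ up o → b o + s o * θ < b e + s e * θ) ∧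
          (∀ e o : ℕ, i + 3 ≤ e → e ≤ i + d + 3 → i + 3 ≤ o → o ≤ i + d + 3 → up e → ¬ up o → b o + s o * θ < b e + s e * θ)))
    (hdis3 : ∀ θ : ℝ, ¬ ((∀ e o : ℕ, i + 3 ≤ e → e ≤ i + d + 3 → i + 3 ≤ o → o ≤ i + d + 3 → up e → ¬ up o → b o + s o * θ < b e + s e * θ) ∧
          (∀ e o : ℕ, i + 4 ≤ e → e ≤ i + d + 4 → i + 4 ≤ o → o ≤ i + d + 4 → up e → ¬ up o → b o + s o * θ < b e + s e * θ)))
    (hdir0 : (∀ θ θ' : ℝ, (∀ e o : ℕ, i ≤ e → e ≤ i + d → i ≤ o → o ≤ i + d → up e → ¬ up o → b o + s o * θ < b e + s e * θ) →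
          (∀ e o : ℕ, i + 1 ≤ e → e ≤ i + d + 1 → i + 1 ≤ o → o ≤ i + d + 1 → up e → ¬ up o → b o + s o * θ' < b e + s e * θ') → θ < θ') ∨
      (∀ θ θ' : ℝ, (∀ e o : ℕ, i ≤ e → e ≤ i + d → i ≤ o → o ≤ i + d → up e → ¬ up o → b o + s o * θ < b e + s e * θ) →
            (∀ e o : ℕ, i + 1 ≤ e → e ≤ i + d + 1 → i + 1 ≤ o → o ≤ i + d + 1 → up e → ¬ up o → b o + s o * θ' < b e + s e * θ') → θ' < θ))
    (hR1 : ∀ θ θ' : ℝ, (∀ e o : ℕ, i + 1 ≤ e → e ≤ i + d + 1 → i + 1 ≤ o → o ≤ i + d + 1 → up e → ¬ up o → b o + s o * θ < b e + s e * θ) →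
          (∀ e o : ℕ, i + 2 ≤ e → e ≤ i + d + 2 → i + 2 ≤ o → o ≤ i + d + 2 → up e → ¬ up o → b o + s o * θ' < b e + s e * θ') → θ < θ')
    (hL2 : ∀ θ θ' : ℝ, (∀ e o : ℕ, i + 2 ≤ e → e ≤ i + d + 2 → i + 2 ≤ o → o ≤ i + d + 2 → up e → ¬ up o → b o + s o * θ < b e + s e * θ) →
          (∀ e o : ℕ, i + 3 ≤ e → e ≤ i + d + 3 → i + 3 ≤ o → o ≤ i + d + 3 → up e → ¬ up o → b o + s o * θ' < b e + s e * θ') → θ' < θ)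
    (hR3 : ∀ θ θ' : ℝ, (∀ e o : ℕ, i + 3 ≤ e → e ≤ i + d + 3 → i + 3 ≤ o → o ≤ i + d + 3 → up e → ¬ up o → b o + s o * θ < b e + s e * θ) →
          (∀ e o : ℕ, i + 4 ≤ e → e ≤ i + d + 4 → i + 4 ≤ o → o ≤ i + d + 4 → up e → ¬ up o → b o + s o * θ' < b e + s e * θ') → θ < θ') : False := by
  have hd2 : 2 ≤ d := by omega
  -- the two monotonicities (triple laws) and the whole-interval orders
  have hmono : s (i + 2) < s (i + d + 1) :=
    triple_mid_right up s b i d hd2 hlow1 hup2 hup1 hlow2 hup3 hA0 hA1 hA2 hA3 hdis0 hdis1 hdis2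
      (hdir0.imp id (fun hL θ θ' h h' => hL θ' θ h' h)) hR1 (Or.inr hL2)
  have hmono' : s (i + 3) < s (i + d + 2) :=
    mono_low up s b i d hd2 hup2 hlow3 hlow2 hup3 hlow4 hA1 hA2 hA3 hA4 hdis1 hdis2 hdis3 (Or.inl hR1) hL2 (Or.inl hR3)
  have h03 := sep0_lt_sep3 up s b i d hd2 hup2 hup1 hmono hdis0 hdis2
  have h41 := sep4_lt_sep1 up s b i d hd2 hlow3 hlow2 hmono' hdis1 hdis3
  -- the look-back structure at `r₃ = sup T[i+3, i+d+3]` (rows `i+2`, `i+3` in the pattern `(L, R)`)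
  obtain ⟨r₃, heq3, -, -, hdomr, hsup, happrox, hgt4, -⟩ :=
    lookback_partner up s b (i + 2) d (by omega)
      (by rw [(by omega : i + 2 + 1 = i + 3)]; exact hlow3)
      (by rw [(by omega : i + 2 + 2 = i + 4)]; exact hup4)
      (by rw [(by omega : i + 2 + d + 2 = i + d + 4)]; exact hlow4)
      (hA2.imp fun θ h => sep_cast up s b _ _ _ _ rfl (by omega) θ h)
      (hA3.imp fun θ h => sep_cast up s b _ _ _ _ (by omega) (by omega) θ h)
      (hA4.imp fun θ h => sep_cast up s b _ _ _ _ (by omega) (by omega) θ h)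
      (fun θ θ' h h' => hL2 θ' θ (sep_cast up s b _ _ _ _ rfl (by omega) θ' h')
        (sep_cast up s b _ _ _ _ (by omega) (by omega) θ h))
      (fun θ h => hdis3 θ ⟨sep_cast up s b _ _ _ _ (by omega) (by omega) θ h.1,
        sep_cast up s b _ _ _ _ (by omega) (by omega) θ h.2⟩)
      (fun θ θ' h h' => hR3 θ θ' (sep_cast up s b _ _ _ _ (by omega) (by omega) θ h)
        (sep_cast up s b _ _ _ _ (by omega) (by omega) θ' h'))
  obtain ⟨θ₀, hθ₀⟩ := hA0
  obtain ⟨θ₁, hθ₁⟩ := hA1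
  obtain ⟨θ₃, hθ₃⟩ := hA3
  obtain ⟨θ₄, hθ₄⟩ := hA4
  have har : θ₀ ≤ r₃ :=
    le_trans (le_of_lt (h03 θ₀ θ₃ hθ₀ hθ₃)) (hsup θ₃ (sep_cast up s b _ _ _ _ (by omega) (by omega) θ₃ hθ₃))
  have hcr : r₃ ≤ θ₁ :=
    le_trans (le_of_lt (hgt4 θ₄ (sep_cast up s b _ _ _ _ (by omega) (by omega) θ₄ hθ₄)))
      (le_of_lt (h41 θ₄ θ₁ hθ₄ hθ₁))
  have ha' : b (i + 3) + s (i + 3) * θ₀ < b (i + 2) + s (i + 2) * θ₀ :=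
    hθ₀ (i + 2) (i + 3) (by omega) (by omega) (by omega) (by omega) hup2 hlow3
  have hc' : b (i + 3) + s (i + 3) * θ₁ < b (i + 2) + s (i + 2) * θ₁ :=
    hθ₁ (i + 2) (i + 3) (by omega) (by omega) (by omega) (by omega) hup2 hlow3
  -- row-`(i+2)` exactness near `r₃`, witnessed by the pair `(i+2, i+d+2)`: `S_{i+2}(r₃) ≤ S_{i+d+2}(r₃)`
  have hle : b (i + 2) + s (i + 2) * r₃ ≤ b (i + d + 2) + s (i + d + 2) * r₃ := by
    refine affine_le_at_sup (s (i + 2)) (b (i + 2)) (s (i + d + 2)) (b (i + d + 2)) r₃ ?_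
    intro ε hε
    obtain ⟨θ, hθ, hθr⟩ := happrox ε hε
    have hθ' : (∀ e o : ℕ, i + 3 ≤ e → e ≤ i + d + 3 → i + 3 ≤ o → o ≤ i + d + 3 → up e → ¬ up o → b o + s o * θ < b e + s e * θ) :=
      sep_cast up s b _ _ _ _ (by omega) (by omega) θ hθ
    refine ⟨θ, ?_, hθr, hsup θ hθ⟩
    refine old_up_le up s b i d θ hup2 hθ' (not_sep_left up s b i d θ (hdis2 θ)) ?_
    intro o h1 h2 ho hne
    have hod : o ≤ i + d := by
      by_contra hlt
      have h13 : o = i + d + 1 ∨ o = i + d + 3 := by omega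
      rcases h13 with h13 | h13
      · rw [h13] at ho; exact ho hup1
      · rw [h13] at ho; exact ho hup3
    have hθa : θ₀ ≤ θ := le_of_lt (h03 θ₀ θ hθ₀ hθ')
    have hθc : θ ≤ θ₁ := le_of_lt (lt_trans (hR3 θ θ₄ hθ' hθ₄) (h41 θ₄ θ₁ hθ₄ hθ₁))
    have pa : b o + s o * θ₀ < b (i + 2) + s (i + 2) * θ₀ :=
      hθ₀ (i + 2) o (by omega) (by omega) (by omega) hod hup2 ho
    have pc : b o + s o * θ₁ < b (i + 2) + s (i + 2) * θ₁ :=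
      hθ₁ (i + 2) o (by omega) (by omega) (by omega) (by omega) hup2 ho
    have key := affine_pos_between (b (i + 2) - b o) (s (i + 2) - s o) θ₀ θ₁ θ hθa hθc (by linarith)
      (by linarith)
    linarith
  -- the chain at `r₃`: `S_{i+2} ≤ S_{i+d+2} ≤ S_{i+d+3} = S_{i+3}`, against `S_{i+2} - S_{i+3} > 0` at `θ₀` and `θ₁`
  have hdq : b (i + d + 2) + s (i + d + 2) * r₃ ≤ b (i + d + 3) + s (i + d + 3) * r₃ :=
    hdomr (i + d + 3) (i + d + 2) (by omega) (by omega) (by omega) (by omega) hup3 hlow2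
  have e1 : i + 2 + d + 1 = i + d + 3 := by omega
  have e2 : i + 2 + 1 = i + 3 := by omega
  rw [e1, e2] at heq3
  have hr : (b (i + 2) - b (i + 3)) + (s (i + 2) - s (i + 3)) * r₃ ≤ 0 := by linarith
  exact affine_three_point (b (i + 2) - b (i + 3)) (s (i + 2) - s (i + 3)) r₃ θ₀ θ₁ hr har (by linarith) hcr
    (by linarith)

end Summit.ValiantsHypothesis.ValiantsHypothesis.Theorems.KPlusLogSqLawStepFourLook
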